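import Summits.Ventures.LatticeQCDFlow.Scaling.HomLadderAugmentation
import Summits.Ventures.LatticeQCDFlow.Scaling.LadderStaleWeights
import Summits.Ventures.LatticeQCDFlow.Scaling.IdealStarFreshness

/-!
HONEST FRAMING: exact (Metropolis-corrected) sampling algorithms for lattice gauge theory; figures
of merit are autocorrelation/cost numbers at stated couplings and volumes; no continuum-physics
claim.

# HomLadderFreshness — CLEAN POSITIONS OF THE HOMOGENEOUS LADDER ARE EXACTLY `ν`-DISTRIBUTED: ALONG THE AUGMENTED CHAIN EVERY COORDINATE OUTSIDE THE STALE SET IS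
# `ν`-EXCHANGEABLE, HENCE `δ_xPⁿ ≥ P(D_n = ∅)·ν^{⊗}` POINTWISE AND **`‖δ_xPⁿ − ν^{⊗}‖_TV ≤ P(D_n ≠ ∅)`** (lean-2 GEN-47, ours)

Venture-side (OURS).  Cell `lqcd-flow` (pub-lqcd), unit `pub-lqcd-lean-2-g47`, 2026-08-31.  Chapter AG, file 8 — the ceiling side, the probabilistic heart (the ladder analogue of chapter L
file 14, `Scaling/IdealStarFreshness`, whose generic lemmas `fresh_empty_proportional`, `tvDist_le_of_pointwise_ge`, `tensorFun_update_mul_const` it reuses).  Setting and augmented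
chain `P̂` of file 7 (lazy ladder `t·T + h·R + (1−t−h)·I`, one law `ν`, exact hot sampler `M_0(u,·) = ν`; tag = the stale set).  The invariant "given the swap∕redraw schedule, the contents
at clean positions are i.i.d. `ν`, independent of everything else" is carried as the local linear identity FRESH-EXCHANGEABILITY `ν̂(z[k↦v], D)·ν(z_k) = ν̂(z, D)·ν(v)` for `k ∉ D`: an
accepted adjacent swap transports it through the transposition, a redraw re-randomises position `0` by `ν` and commutes with updates elsewhere, the lazy part fixes everything.
Hypothesis-equations `hPh`, `hP`, `hQ`; no definitions.

* §1 `levelSwap_symm`, **`ladder_fresh_step`**, **`ladder_fresh_lawAt`** (fresh-exchangeability at all times from `δ_{(x, univ)}`).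
* §2 **`ladder_lawAt_empty_eq`** (`ν̂_n(z, ∅) = (δ_{univ}Qⁿ)(∅)·ν^{⊗}(z)`).
* §3 **`ladder_minorization`** (`(δ_xPⁿ)(z) ≥ (δ_{univ}Qⁿ)(∅)·ν^{⊗}(z)`), **`ladder_tvDist_le_stale`** (THE FRESHNESS BOUND `‖δ_xPⁿ − ν^{⊗}‖_TV ≤ (δ_{univ}Qⁿ){D ≠ ∅}`),
  **`ladder_worstTvDist_le_stale`**.

Reading (no numerics implied): the homogeneous ladder is as far from equilibrium as the probability that some replica still carries never-refreshed content; file 6 bounds that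
probability by `(1−ρ)ⁿ(K+1)/c_0` through the Robin mode, file 9 assembles the `K³·log K` ceiling.  NOT CLAIMED: unequal laws, inexact hot samplers, non-idle cold kernels (each breaks
acceptance-one or the `ν`-refresh).  Literature grade (cell rule): OWN CONSTRUCTION (chapter L's coupling-from-genealogy invariant on the ladder); nothing cited; no new bib keys.
-/

noncomputable section

open Finset Function
open Literature.Probability.MarkovChains

namespace Summit.Ventures.LatticeQCDFlow.Scaling

variable {S : Type*} [Fintype S] [DecidableEq S] {K : ℕ} {ν : S → ℝ} {M : Fin (K + 1) → S → S → ℝ} {t h : ℝ}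

/-! ## §1 Fresh-exchangeability is preserved -/

omit [Fintype S] [DecidableEq S] in
/-- An adjacent transposition is its own inverse. [ours] -/
theorem levelSwap_symm (j : Fin K) : (levelSwap j).symm = levelSwap j := by
  unfold levelSwap; exact Equiv.symm_swap _ _

section Fresh
variable {Ph : (Fin (K + 1) → S) × Finset (Fin (K + 1)) → (Fin (K + 1) → S) × Finset (Fin (K + 1)) → ℝ}
  {P : (Fin (K + 1) → S) → (Fin (K + 1) → S) → ℝ} {Q : Finset (Fin (K + 1)) → Finset (Fin (K + 1)) → ℝ}

/-- **FRESH-EXCHANGEABILITY IS PRESERVED BY ONE STEP** of the augmented ladder (`M_0(u,·) = ν`): if `λ(z[k↦v], D)·ν(z_k) = λ(z, D)·ν(v)` for all `k ∉ D`, the same holds for `λP̂`.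
[ours] -/
theorem ladder_fresh_step (hM0 : ∀ u v, M 0 u v = ν v)
    (hPh : ∀ p q, Ph p q = (∑ j : Fin K, t / K * (if q.1 = p.1 ∘ levelSwap j ∧ q.2 = p.2.image (levelSwap j) then (1 : ℝ) else 0))
      + h * (coordKernel M 0 p.1 q.1 * (if q.2 = p.2.erase 0 then (1 : ℝ) else 0)) + (1 - t - h) * (if q.1 = p.1 ∧ q.2 = p.2 then (1 : ℝ) else 0))
    {lam : (Fin (K + 1) → S) × Finset (Fin (K + 1)) → ℝ}
    (hlam : ∀ (z : Fin (K + 1) → S) (D : Finset (Fin (K + 1))) (k : Fin (K + 1)) (v : S), k ∉ D →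
      lam (update z k v, D) * ν (z k) = lam (z, D) * ν v) :
    ∀ (z : Fin (K + 1) → S) (D : Finset (Fin (K + 1))) (k : Fin (K + 1)) (v : S), k ∉ D →
      stepLaw Ph lam (update z k v, D) * ν (z k) = stepLaw Ph lam (z, D) * ν v := by
  intro z D k v hk
  rw [ladder_stepLaw_apply hPh lam (update z k v) D, ladder_stepLaw_apply hPh lam z D, add_mul, add_mul, add_mul, add_mul,
    Finset.sum_mul, Finset.sum_mul]
  congr 1
  congr 1
  · -- swaps: transport the relation through the transposition `σ_j`
    refine sum_congr rfl fun j _ => ?_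
    have hsw : update z k v ∘ levelSwap j = update (z ∘ levelSwap j) (levelSwap j k) v := by
      rw [Function.update_comp_equiv, levelSwap_symm]
    have hzk : z k = (z ∘ levelSwap j) (levelSwap j k) := by
      simp only [Function.comp_apply, levelSwap, Equiv.swap_apply_self]
    have hk' : levelSwap j k ∉ D.image (levelSwap j) := by
      rw [Finset.mem_image]
      rintro ⟨i, hi, hik⟩
      exact hk ((levelSwap j).injective hik ▸ hi)
    rw [hsw, hzk, mul_assoc, hlam _ _ _ _ hk', ← mul_assoc]
  · -- redraws
    rw [mul_assoc, mul_assoc]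
    congr 1
    rw [Finset.sum_mul, Finset.sum_mul]
    refine sum_congr rfl fun D₀ hD₀ => ?_
    have hD₀' : D₀.erase 0 = D := (Finset.mem_filter.mp hD₀).2
    rw [Finset.sum_mul, Finset.sum_mul]
    refine sum_congr rfl fun u _ => ?_
    simp_rw [hM0]
    by_cases hk0 : k = 0
    · subst hk0
      rw [update_idem, update_self]
      ring
    · have hkD₀ : k ∉ D₀ := fun h' => hk (hD₀' ▸ Finset.mem_erase.mpr ⟨hk0, h'⟩)
      rw [update_comm hk0, update_of_ne (Ne.symm hk0)]
      have h' := hlam (update z 0 u) D₀ k v hkD₀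
      rw [update_of_ne hk0] at h'
      calc lam (update (update z 0 u) k v, D₀) * ν (z 0) * ν (z k)
          = (lam (update (update z 0 u) k v, D₀) * ν (z k)) * ν (z 0) := by ring
        _ = (lam (update z 0 u, D₀) * ν v) * ν (z 0) := by rw [h']
        _ = lam (update z 0 u, D₀) * ν (z 0) * ν v := by ring
  · -- the lazy part
    rw [mul_assoc, mul_assoc, hlam z D k v hk]

/-- **FRESH-EXCHANGEABILITY AT ALL TIMES:** from `δ_{(x, univ)}`, `ν̂_n(z[k↦v], D)·ν(z_k) = ν̂_n(z, D)·ν(v)` for every `n`, `z`, `D`, `v` and `k ∉ D`. [ours] -/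
theorem ladder_fresh_lawAt (hM0 : ∀ u v, M 0 u v = ν v)
    (hPh : ∀ p q, Ph p q = (∑ j : Fin K, t / K * (if q.1 = p.1 ∘ levelSwap j ∧ q.2 = p.2.image (levelSwap j) then (1 : ℝ) else 0))
      + h * (coordKernel M 0 p.1 q.1 * (if q.2 = p.2.erase 0 then (1 : ℝ) else 0)) + (1 - t - h) * (if q.1 = p.1 ∧ q.2 = p.2 then (1 : ℝ) else 0))
    (x : Fin (K + 1) → S) :
    ∀ (n : ℕ) (z : Fin (K + 1) → S) (D : Finset (Fin (K + 1))) (k : Fin (K + 1)) (v : S), k ∉ D →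
      lawAt Ph (Pi.single (x, (univ : Finset (Fin (K + 1)))) 1) n (update z k v, D) * ν (z k)
        = lawAt Ph (Pi.single (x, (univ : Finset (Fin (K + 1)))) 1) n (z, D) * ν v := by
  intro n
  induction n with
  | zero =>
    intro z D k v hk
    have hD : D ≠ univ := fun h' => hk (h' ▸ mem_univ k)
    rw [lawAt_zero, Pi.single_eq_of_ne (fun h' => hD (Prod.mk.inj h').2), Pi.single_eq_of_ne (fun h' => hD (Prod.mk.inj h').2), zero_mul, zero_mul]
  | succ n ih =>
    intro z D k v hk
    rw [lawAt_succ]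
    exact ladder_fresh_step hM0 hPh ih z D k v hk

/-! ## §2 On the empty tag the law is `π̃` times the probability of an empty stale set -/

/-- **`ν̂_n(z, ∅) = (δ_{univ}Qⁿ)(∅)·ν^{⊗}(z)`.** [ours] -/
theorem ladder_lawAt_empty_eq (hν : ∀ v, 0 < ν v) (hν1 : ∑ v, ν v = 1) (hM : ∀ k, IsRowStochastic (M k)) (hM0 : ∀ u v, M 0 u v = ν v)
    (hPh : ∀ p q, Ph p q = (∑ j : Fin K, t / K * (if q.1 = p.1 ∘ levelSwap j ∧ q.2 = p.2.image (levelSwap j) then (1 : ℝ) else 0))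
      + h * (coordKernel M 0 p.1 q.1 * (if q.2 = p.2.erase 0 then (1 : ℝ) else 0)) + (1 - t - h) * (if q.1 = p.1 ∧ q.2 = p.2 then (1 : ℝ) else 0))
    (hQ : ∀ D D', Q D D' = (∑ j : Fin K, t / K * (if D' = D.image (levelSwap j) then (1 : ℝ) else 0))
      + h * (if D' = D.erase 0 then (1 : ℝ) else 0) + (1 - t - h) * (if D' = D then (1 : ℝ) else 0))
    (x : Fin (K + 1) → S) (n : ℕ) (z : Fin (K + 1) → S) :
    lawAt Ph (Pi.single (x, (univ : Finset (Fin (K + 1)))) 1) n (z, ∅)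
      = lawAt Q (Pi.single (univ : Finset (Fin (K + 1))) 1) n ∅ * tensorFun (fun _ : Fin (K + 1) => ν) z := by
  have hprop := fresh_empty_proportional hν (ladder_fresh_lawAt hM0 hPh x n)
  have hπ1 : ∑ z', tensorFun (fun _ : Fin (K + 1) => ν) z' = 1 := sum_tensorFun_eq_one _ (fun _ => hν1)
  have hsum : lawAt Ph (Pi.single (x, (univ : Finset (Fin (K + 1)))) 1) n (z, ∅) * ∑ z', tensorFun (fun _ : Fin (K + 1) => ν) z'
      = (∑ z', lawAt Ph (Pi.single (x, (univ : Finset (Fin (K + 1)))) 1) n (z', ∅)) * tensorFun (fun _ : Fin (K + 1) => ν) z := by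
    rw [Finset.mul_sum, Finset.sum_mul]
    exact sum_congr rfl fun z' _ => hprop z z'
  rw [hπ1, mul_one, ladder_lawAt_snd hM hPh hQ x n ∅] at hsum
  exact hsum

/-! ## §3 Minorisation and the freshness bound -/

/-- **MINORISATION: `(δ_xPⁿ)(z) ≥ (δ_{univ}Qⁿ)(∅)·ν^{⊗}(z)`** for the lazy homogeneous ladder, every start `x` (`K ≥ 1`, `t, h ≥ 0`, `t + h ≤ 1`). [ours] -/
theorem ladder_minorization (hK : 1 ≤ K) (ht0 : 0 ≤ t) (hh0 : 0 ≤ h) (hth : t + h ≤ 1) (hν : ∀ v, 0 < ν v) (hν1 : ∑ v, ν v = 1)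
    (hM : ∀ k, IsRowStochastic (M k)) (hM0 : ∀ u v, M 0 u v = ν v)
    (hP : ∀ x y, P x y = t * ptBareProposal x y + h * coordKernel M 0 x y + (1 - t - h) * (if y = x then 1 else 0))
    (hQ : ∀ D D', Q D D' = (∑ j : Fin K, t / K * (if D' = D.image (levelSwap j) then (1 : ℝ) else 0))
      + h * (if D' = D.erase 0 then (1 : ℝ) else 0) + (1 - t - h) * (if D' = D then (1 : ℝ) else 0))
    (x : Fin (K + 1) → S) (n : ℕ) (z : Fin (K + 1) → S) :
    lawAt Q (Pi.single (univ : Finset (Fin (K + 1))) 1) n ∅ * tensorFun (fun _ : Fin (K + 1) => ν) z ≤ lawAt P (Pi.single x 1) n z := by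
  set Ph : (Fin (K + 1) → S) × Finset (Fin (K + 1)) → (Fin (K + 1) → S) × Finset (Fin (K + 1)) → ℝ :=
    fun p q => (∑ j : Fin K, t / K * (if q.1 = p.1 ∘ levelSwap j ∧ q.2 = p.2.image (levelSwap j) then (1 : ℝ) else 0))
      + h * (coordKernel M 0 p.1 q.1 * (if q.2 = p.2.erase 0 then (1 : ℝ) else 0)) + (1 - t - h) * (if q.1 = p.1 ∧ q.2 = p.2 then (1 : ℝ) else 0)
    with hPh_def
  have hPh : ∀ p q, Ph p q = (∑ j : Fin K, t / K * (if q.1 = p.1 ∘ levelSwap j ∧ q.2 = p.2.image (levelSwap j) then (1 : ℝ) else 0))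
      + h * (coordKernel M 0 p.1 q.1 * (if q.2 = p.2.erase 0 then (1 : ℝ) else 0)) + (1 - t - h) * (if q.1 = p.1 ∧ q.2 = p.2 then (1 : ℝ) else 0) :=
    fun p q => rfl
  rw [← ladder_lawAt_fst hPh hP x n z, ← ladder_lawAt_empty_eq hν hν1 hM hM0 hPh hQ x n z]
  have hnn : ∀ q, 0 ≤ lawAt Ph (Pi.single (x, (univ : Finset (Fin (K + 1)))) 1) n q := fun q =>
    lawAt_nonneg (ladder_aug_isRowStochastic hK ht0 hh0 hth hM hPh) (fun p => by
      by_cases hp : p = (x, (univ : Finset (Fin (K + 1))))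
      · subst hp; rw [Pi.single_eq_same]; norm_num
      · rw [Pi.single_eq_of_ne hp]) n q
  exact Finset.single_le_sum (f := fun D => lawAt Ph (Pi.single (x, (univ : Finset (Fin (K + 1)))) 1) n (z, D)) (fun D _ => hnn (z, D)) (mem_univ ∅)

/-- **THE FRESHNESS BOUND: `‖δ_xPⁿ − ν^{⊗}‖_TV ≤ (δ_{univ}Qⁿ){D ≠ ∅}`** for the lazy homogeneous ladder from every start. [ours] -/
theorem ladder_tvDist_le_stale (hK : 1 ≤ K) (ht0 : 0 ≤ t) (hh0 : 0 ≤ h) (hth : t + h ≤ 1) (hν : ∀ v, 0 < ν v) (hν1 : ∑ v, ν v = 1)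
    (hM : ∀ k, IsRowStochastic (M k)) (hM0 : ∀ u v, M 0 u v = ν v) (hPst : IsRowStochastic P)
    (hP : ∀ x y, P x y = t * ptBareProposal x y + h * coordKernel M 0 x y + (1 - t - h) * (if y = x then 1 else 0))
    (hQ : ∀ D D', Q D D' = (∑ j : Fin K, t / K * (if D' = D.image (levelSwap j) then (1 : ℝ) else 0))
      + h * (if D' = D.erase 0 then (1 : ℝ) else 0) + (1 - t - h) * (if D' = D then (1 : ℝ) else 0))
    (x : Fin (K + 1) → S) (n : ℕ) :
    tvDist (lawAt P (Pi.single x 1) n) (tensorFun (fun _ : Fin (K + 1) => ν))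
      ≤ ∑ D ∈ univ.filter (fun D : Finset (Fin (K + 1)) => D ≠ ∅), lawAt Q (Pi.single (univ : Finset (Fin (K + 1))) 1) n D := by
  have hμ : ∀ (k : Fin (K + 1)) (v : S), 0 < (fun _ : Fin (K + 1) => ν) k v := fun _ v => hν v
  have hQst := stale_isRowStochastic hK ht0 hh0 hth hQ
  have hmassQ : ∑ D, lawAt Q (Pi.single (univ : Finset (Fin (K + 1))) 1) n D = 1 := by
    rw [sum_lawAt hQst, Finset.sum_pi_single', if_pos (mem_univ _)]
  have hsplit := Finset.sum_filter_add_sum_filter_not univ (fun D : Finset (Fin (K + 1)) => D ≠ ∅)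
    (fun D => lawAt Q (Pi.single (univ : Finset (Fin (K + 1))) 1) n D)
  have hE : univ.filter (fun D : Finset (Fin (K + 1)) => ¬D ≠ ∅) = {∅} := by
    ext D; simp only [Finset.mem_filter, Finset.mem_univ, true_and, not_not, Finset.mem_singleton]
  rw [hmassQ, hE, Finset.sum_singleton] at hsplit
  have htv := tvDist_le_of_pointwise_ge (fun z => (tensorFun_pos hμ z).le) (sum_tensorFun_eq_one _ (fun _ => hν1))
    (by rw [sum_lawAt hPst, Finset.sum_pi_single', if_pos (mem_univ _)])
    (fun z => ladder_minorization hK ht0 hh0 hth hν hν1 hM hM0 hP hQ x n z)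
  linarith

/-- **THE FRESHNESS BOUND FOR THE WORST START: `d(n) ≤ (δ_{univ}Qⁿ){D ≠ ∅}`.** [ours] -/
theorem ladder_worstTvDist_le_stale (hK : 1 ≤ K) (ht0 : 0 ≤ t) (hh0 : 0 ≤ h) (hth : t + h ≤ 1) (hν : ∀ v, 0 < ν v) (hν1 : ∑ v, ν v = 1)
    (hM : ∀ k, IsRowStochastic (M k)) (hM0 : ∀ u v, M 0 u v = ν v) (hPst : IsRowStochastic P)
    (hP : ∀ x y, P x y = t * ptBareProposal x y + h * coordKernel M 0 x y + (1 - t - h) * (if y = x then 1 else 0))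
    (hQ : ∀ D D', Q D D' = (∑ j : Fin K, t / K * (if D' = D.image (levelSwap j) then (1 : ℝ) else 0))
      + h * (if D' = D.erase 0 then (1 : ℝ) else 0) + (1 - t - h) * (if D' = D then (1 : ℝ) else 0)) (n : ℕ) :
    worstTvDist P (tensorFun (fun _ : Fin (K + 1) => ν)) n
      ≤ ∑ D ∈ univ.filter (fun D : Finset (Fin (K + 1)) => D ≠ ∅), lawAt Q (Pi.single (univ : Finset (Fin (K + 1))) 1) n D := by
  have hQst := stale_isRowStochastic hK ht0 hh0 hth hQ
  have hbound : 0 ≤ ∑ D ∈ univ.filter (fun D : Finset (Fin (K + 1)) => D ≠ ∅), lawAt Q (Pi.single (univ : Finset (Fin (K + 1))) 1) n D :=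
    sum_nonneg fun D _ => lawAt_nonneg hQst (fun U => by
      by_cases hU : U = univ
      · subst hU; rw [Pi.single_eq_same]; norm_num
      · rw [Pi.single_eq_of_ne hU]) n D
  unfold worstTvDist
  exact Real.iSup_le (fun x => ladder_tvDist_le_stale hK ht0 hh0 hth hν hν1 hM hM0 hPst hP hQ x n) hbound

end Fresh

end Summit.Ventures.LatticeQCDFlow.Scaling

end
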